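import Mathlib
import HarnessLib
import Summits.QuantumFields.Statement
import Summits.QuantumFields.QCD.Theses.HeatSlicedQuarks

/-!
# Sketch — crux idea `real-modes-cost-curvature` (crux stmt-QuantumFields-11513, `PauliWegnerSea.OneScaleTrajectory`)

Round 2, ideator 5 (planner-cruxidea-stmt-QuantumFields-11513-5-0), 2026-08-16.

First lemmas of the line, stated over existing declarations (they need not be proved here; they must
elaborate).  Conventions as in the tree's `wilsonDirac` (`GrassmannIntegral.lean:326`):
`D_W(U,m,r) = m + r·W_U + K_U` with `W_U = Σ_μ (1 − ½(T_μ + T_μ†)) ≥ 0` (covariant Wilson Laplacian form,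
`⟨v, W_U v⟩ = ½ Σ_{x,μ} ‖U(x,μ)v(x+μ̂) − v(x)‖²`, the kinetic form of `HeatSlicedQuarks.WilsonLichnerowicz`)
and `K_U = ½ Σ_μ γ_μ (T_μ − T_μ†)` anti-Hermitian.

* `RealModeKinetic`      — W-CRITICALITY of real modes: `D_W(U,0,1) φ = λ φ`, `λ ∈ ℝ` ⇒ the covariant kinetic
                            energy of `φ` is EXACTLY `λ‖φ‖²` (so sign-active modes, `λ ≤ τ_k → 0`, are covariantly
                            smooth; pure algebra: `⟨φ,Kφ⟩ ∈ iℝ`, `⟨φ,Wφ⟩ ∈ ℝ`).  [provable now]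
* `RealModeCurvaturePin`  — the tree's Lichnerowicz form bound applied to a real mode: the `|φ|²`-weighted local
                            (square-root) plaquette action is `≥ λ(1−λ)/C`.  [provable now from stmt-8874]
* `RealModeSpread`        — Kato + discrete Sobolev (`ℓ⁴ ⊂ ℓ^∞` in `d = 4`): the site density of a real mode is
                            `≤ C(λ + L⁻²)‖φ‖²`, i.e. the mode occupies `≳ 1/(λ + L⁻²)` sites.  [size M]
* `RealModeActionQuantum` — consequence: a real eigenvalue in `[L⁻², 1/2]` forces total Wilson action `≥ q`. [M]
-/

namespace Summit.QuantumFields.QCD.Cruxes.OneScaleTrajectory.RealModesCostCurvature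

open scoped BigOperators Matrix ComplexConjugate
open Literature.MathematicalPhysics.QuantumLattice Literature.MathematicalPhysics.QuantumFieldTheory
  Literature.Probability.LatticeModels

local notation "SU3" => Matrix.specialUnitaryGroup (Fin 3) ℂ

/-- Covariant kinetic energy (Lichnerowicz kinetic form of the tree, = `2⟨v, W_U v⟩`):
`Σ_{x,μ,a,α} ‖Σ_b ρ(U(x,μ))_{ab} v(x+μ̂,b,α) − v(x,a,α)‖²`. -/
noncomputable def kinetic {L : ℕ} [NeZero L] (U : GaugeConfig 4 L SU3)
    (v : TorusSite 4 L × Fin 3 × Fin 4 → ℂ) : ℝ :=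
  ∑ x : TorusSite 4 L, ∑ μ : Fin 4, ∑ a : Fin 3, ∑ α : Fin 4,
    ‖(∑ b : Fin 3, (fundamentalRep (Fin 3) (U (x, μ))) a b * v (Site.shift x μ, b, α)) - v (x, a, α)‖ ^ 2

/-- Site density of a quark field: `Σ_{a,α} ‖v(x,a,α)‖²`. -/
noncomputable def siteDensity {L : ℕ} (v : TorusSite 4 L × Fin 3 × Fin 4 → ℂ) (x : TorusSite 4 L) : ℝ :=
  ∑ a : Fin 3, ∑ α : Fin 4, ‖v (x, a, α)‖ ^ 2

/-- The local square-root plaquette action of `HeatSlicedQuarks.WilsonLichnerowicz`: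
`V(U,x) = Σ_{torusDist x y ≤ 3} Σ_{μ,ν} √(3 − Re tr U_{y,μν})`. -/
noncomputable def localRootAction {L : ℕ} [NeZero L] (U : GaugeConfig 4 L SU3) (x : TorusSite 4 L) : ℝ :=
  ∑ y ∈ Finset.univ.filter (fun y : TorusSite 4 L => torusDist x y ≤ 3), ∑ μ : Fin 4, ∑ ν : Fin 4,
    Real.sqrt (3 - ((fundamentalRep (Fin 3)) (plaquetteHolonomy U y μ ν)).trace.re)

/-- A real eigenpair of the massless `r = 1` Wilson–Dirac operator. -/
def IsRealMode {L : ℕ} [NeZero L] (U : GaugeConfig 4 L SU3)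
    (φ : TorusSite 4 L × Fin 3 × Fin 4 → ℂ) (lam : ℝ) : Prop :=
  φ ≠ 0 ∧ (wilsonDirac (fundamentalRep (Fin 3)) U 0 1).mulVec φ = (lam : ℂ) • φ

/-- **L1 (W-criticality, HoleLemma of the interacting operator).** For a real eigenpair
`D_W(U,0,1)φ = λφ`: the covariant kinetic energy equals `2λ‖φ‖²` (equivalently `λ = ⟨φ,W_Uφ⟩/‖φ‖²`,
in particular `0 ≤ λ ≤ 8`).  Pure algebra: `⟨φ, K_U φ⟩` is imaginary, `⟨φ, W_U φ⟩` real. -/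
def RealModeKinetic : Prop :=
  ∀ (L : ℕ) [NeZero L] (U : GaugeConfig 4 L SU3) (φ : TorusSite 4 L × Fin 3 × Fin 4 → ℂ) (lam : ℝ),
    IsRealMode U φ lam → kinetic U φ = 2 * lam * ∑ i, ‖φ i‖ ^ 2

/-- **L2 (curvature pin of a real mode).** From `HeatSlicedQuarks.WilsonLichnerowicz`
(`½·kinetic ≤ ‖D_W(U,m,1)v‖² + C Σ_x V(U,x)|v(x)|²` at `m = 0`) and L1: a real mode with eigenvalue
`λ` has `|φ|²`-weighted local root-action at least `λ(1−λ)/C`: curvature must sit where the mode sits. -/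
def RealModeCurvaturePin : Prop :=
  ∃ C : ℝ, 0 < C ∧ ∀ (L : ℕ) [NeZero L] (U : GaugeConfig 4 L SU3) (φ : TorusSite 4 L × Fin 3 × Fin 4 → ℂ)
    (lam : ℝ), IsRealMode U φ lam →
      lam * (1 - lam) * ∑ i, ‖φ i‖ ^ 2 ≤ C * ∑ x : TorusSite 4 L, localRootAction U x * siteDensity φ x

/-- The tree's Lichnerowicz form bound gives L2 (the only input besides L1). -/
def CurvaturePinOfLichnerowicz : Prop :=
  Summit.QuantumFields.QCD.Theses.HeatSlicedQuarks.WilsonLichnerowicz → RealModeKinetic → RealModeCurvaturePin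

/-- **L3 (sign-active modes are extended).** Kato's inequality for the covariant kinetic form plus the discrete
Sobolev inequality on the `4`-torus (`‖f‖_∞² ≤ ‖f‖_4² ≤ C(‖∇f‖₂² + L⁻²‖f‖₂²)`) and L1: the site density of a
real mode is at most `C(λ + L⁻²)‖φ‖²` — a mode with `λ ≤ τ` occupies at least `1/(C(τ + L⁻²))` sites. -/
def RealModeSpread : Prop :=
  ∃ C : ℝ, 0 < C ∧ ∀ (L : ℕ) [NeZero L] (U : GaugeConfig 4 L SU3) (φ : TorusSite 4 L × Fin 3 × Fin 4 → ℂ)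
    (lam : ℝ), IsRealMode U φ lam → ∀ x : TorusSite 4 L,
      siteDensity φ x ≤ C * (lam + 1 / (L : ℝ) ^ 2) * ∑ i, ‖φ i‖ ^ 2

/-- **L4 (action quantum).** L2 + L3 + `Σ_x V(U,x)² ≤ C' · wilsonAction U` (Cauchy–Schwarz over the ≤ C″ plaquettes
near a site): a real eigenvalue of `D_W(U,0,1)` in `[L⁻², 1/2]` forces `wilsonAction U ≥ q` for a universal `q > 0`
(soft-analysis quantum; the classical sharp value for the SIGNED Bochner budget is `2π² … 4π²`, see the card). -/
def RealModeActionQuantum : Prop :=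
  ∃ q : ℝ, 0 < q ∧ ∀ (L : ℕ) [NeZero L] (U : GaugeConfig 4 L SU3) (φ : TorusSite 4 L × Fin 3 × Fin 4 → ℂ)
    (lam : ℝ), IsRealMode U φ lam → 1 / (L : ℝ) ^ 2 ≤ lam → lam ≤ 1 / 2 →
      q ≤ wilsonAction (fundamentalRep (Fin 3)) U

/-- The composition of the first lemmas (logic only once L2, L3 and the plaquette-count bound are in hand). -/
def ActionQuantumOfPins : Prop :=
  RealModeCurvaturePin → RealModeSpread → RealModeActionQuantum

end Summit.QuantumFields.QCD.Cruxes.OneScaleTrajectory.RealModesCostCurvature
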